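import Summits.CriticalPhenomena.PercolationContinuityZ3.Theorems.Transplant.SkelPhiRectPrism
import HarnessLib

/-!
# D″ node, STRUCTURE-FREE layer L5′.1 (V98 p3 column; DPRIME-SCOPE §2 L5′ "`SkelCubeAt` ↦ `SkelNRectAt`"; P4-GENERAL §16.4 (U1′)): reaching planar
# points by OUTWARD STEPS (the φ-level column fact), and the BAND RECTANGLE BEHIND A SEED SLAB — given a slab centre `t`, an inward normal `(i, σ)`,
# the slab half-width `ℓs` and the rectangle half-widths `a`, the kit is the fat rectangle `rectPrism c a R` at the `Steps`-vertex `c` with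
# `φ c = φ t − (ℓs + 1 + a_i) σ e_i`; its NEAR SIDE `rside c a R i σ` faces the slab at skeleton depth exactly `ℓs + 1`, and every near-side vertex
# has its outward `Steps`-neighbour inside the slab's fat prism — φ-level re-cut of `PlanarSkeletonPrisms` §4 and `SkelCubeAt` §2–§3 with the square
# cube `fatSeq c M` / quarter-face `cubeFace` replaced by the rectangle `rectPrism c a R` / directed side `rside … i σ` (no `HOct 2`, radius `R` free)

builds on p205010 (kernel theorem, internal audit signed; external expert review pending) — nothing in this file uses p205010.
Lane `prim-bschramm`, seat `prim-bschramm-p3` (gen 7; D″ design owner); helper file (`--supports stmt-CriticalPhenomena-4575`).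
Hypotheses through the dictionary: `hstep : Skelφ.Steps G φ` (placement, outward neighbours), `hfr : Skelφ.Frames G φ types` + `hκ : Skelφ.CylConn G φ types`
(only in the last lemma, through `prism_subset_cylBall`), `hΔ` for cardinalities (in `SkelPhiRectPrism`).  The radius `R` of the kit is an ARGUMENT (consumers
take `R := fatRadius hfr hC (amax a)`, K2.3), and so are the half-widths `a` (the band inputs `(ℓ₁, G(ℓ₁))` / `(F⁻¹(e), e)` at the reference density, V98 R3/F2).
* §1 **`exists_mem_graphBall_φ_eq`** (`Steps` ⇒ every planar point `y` is `φ g` for some `g` within graph distance `‖y − φ w₀‖₁` of `w₀`),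
  `exists_mem_ballWindow_φ_eq`, `exists_mem_graphBall_φ_eq_sub_single`;
* §2 **`rectCtr hstep t i σ ℓs a`** (a choice), `rectCtr_spec`, `φ_rectCtr`, `rectCtr_mem_graphBall`; the kit `rectPrism G φ (rectCtr …) a R` and its near side
  **`nearSide hstep t i σ ℓs a R := rside G φ (rectCtr …) a R i σ`**;
* §3 obligations of the near side: **`φ_nearSide`** (exit coordinate `φ t i − σ (ℓs + 1)`, transverse offset `≤ a (oth i)`), `nearSide_subset_graphBall`
  (`⊆ B_G(t, ℓs + 1 + a i + R)`), `nearSide_subset_cyl`, `rectPrism_rectCtr_subset_graphBall`, `rectPrism_rectCtr_subset_cyl` (the whole kit lies in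
  `cyl t (ℓs + 1 + 2 a_i ⊔ a_{i'})` and in `B_G(t, ℓs + 1 + a i + R)`), **`exists_step_mem_cylBall_of_mem_nearSide`** (for `a (oth i) ≤ ℓs`, `1 ≤ ℓs`: each near-side
  vertex has a `G`-neighbour in `cylBall t ℓs (cylRadMax ℓs (ℓs + 2 + a i + R))` — the rung into the seed slab).
[cite: KozmaNitzan2024, §4 Lemma 10 Step III–IV, pp. 19–21 (v(P) + Λ_M, U(P)), p. 26 ((29))] [cite: GrimmettPercolation1999, §7.3 p. 163]
-/

noncomputable section

namespace Summit.CriticalPhenomena.PercolationContinuityZ3.Theorems.Transplant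

namespace Skelφ

open Literature.Probability.Percolation Literature.Probability.LatticeModels SimpleGraph
open Literature.Probability.Percolation.KozmaNitzan.Cells (oth oth_ne oth_oth eq_oth_of_ne)
open Literature.Barriers.CriticalPhenomena (graphBall graphBall_finite mem_graphBall_self graphBall_mono mem_graphBall_map)
open scoped Classical

variable {V : Type} {G : SimpleGraph V} {φ : V → Site 2}

/-! ## §1 Reaching planar points by outward steps (the φ-level column fact) -/

/-- **Under `Steps`, every planar point `y` is the image of a vertex within graph distance `‖y − φ w₀‖₁` of `w₀`.** [cite: KozmaNitzan2024, §4 p. 26 ((29))] -/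
theorem exists_mem_graphBall_φ_eq (hstep : Steps G φ) (w₀ : V) (y : Site 2) :
    ∃ g, g ∈ graphBall G w₀ ((y 0 - φ w₀ 0).natAbs + (y 1 - φ w₀ 1).natAbs) ∧ φ g = y := by
  -- induction on the ℓ¹ distance `n`
  suffices h : ∀ (n : ℕ) (y : Site 2), (y 0 - φ w₀ 0).natAbs + (y 1 - φ w₀ 1).natAbs = n → ∃ g, g ∈ graphBall G w₀ n ∧ φ g = y from h _ y rfl
  intro n
  induction n with
  | zero =>
    intro y hy
    refine ⟨w₀, mem_graphBall_self G w₀ 0, ?_⟩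
    have h0 : (y 0 - φ w₀ 0).natAbs = 0 := by omega
    have h1 : (y 1 - φ w₀ 1).natAbs = 0 := by omega
    funext i
    fin_cases i
    · exact (sub_eq_zero.1 (Int.natAbs_eq_zero.1 h0)).symm
    · exact (sub_eq_zero.1 (Int.natAbs_eq_zero.1 h1)).symm
  | succ n ih =>
    intro y hy
    -- a coordinate `i` with `y i ≠ φ w₀ i`; step back towards the root in that coordinate
    have hex : ∃ i : Fin 2, y i ≠ φ w₀ i := by
      by_contra hcon
      push Not at hcon
      have := hcon 0; have := hcon 1
      simp_all
    obtain ⟨i, hi⟩ := hex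
    set σ : ℤˣ := if φ w₀ i < y i then 1 else -1 with hσdef
    set y' : Site 2 := y - Pi.single i (σ : ℤ) with hy'def
    have hy'i : y' i = y i - (σ : ℤ) := by simp [hy'def]
    have hy'j : ∀ j, j ≠ i → y' j = y j := by intro j hj; simp [hy'def, hj]
    have hdist : (y' 0 - φ w₀ 0).natAbs + (y' 1 - φ w₀ 1).natAbs = n := by
      have key : (y' i - φ w₀ i).natAbs + 1 = (y i - φ w₀ i).natAbs := by
        rw [hy'i]
        by_cases hlt : φ w₀ i < y i
        · have : (σ : ℤ) = 1 := by rw [hσdef, if_pos hlt]; rfl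
          rw [this]; omega
        · have : (σ : ℤ) = -1 := by rw [hσdef, if_neg hlt]; rfl
          rw [this]
          have hgt : y i < φ w₀ i := lt_of_le_of_ne (not_lt.1 hlt) hi
          omega
      fin_cases i
      · have h1 := hy'j 1 (by decide)
        simp only [Fin.zero_eta] at key
        rw [h1]; omega
      · have h0 := hy'j 0 (by decide)
        simp only [Fin.mk_one] at key
        rw [h0]; omega
    obtain ⟨g', hg', hφg'⟩ := ih y' hdist
    obtain ⟨g, hadj, hφg⟩ := hstep g' i σ
    refine ⟨g, BoxProdZ2.mem_graphBall_succ_of_adj G hg' hadj, ?_⟩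
    rw [hφg, hφg', hy'def, sub_add_cancel]

/-- **The column fact for root-centred windows**: under `Steps` the column `φ⁻¹(y)` meets `{g ∈ B_G(w₀, R) | φ g ∈ P}` as soon as `y ∈ P` and `R`
dominates the planar ℓ¹-offset of `y`. [cite: KozmaNitzan2024, §4 p. 26 ((29))] -/
theorem exists_mem_ballWindow_φ_eq (hstep : Steps G φ) (w₀ : V) {P : Set (Site 2)} {y : Site 2} (hy : y ∈ P) {R : ℕ}
    (hR : (y 0 - φ w₀ 0).natAbs + (y 1 - φ w₀ 1).natAbs ≤ R) : ∃ g, (g ∈ graphBall G w₀ R ∧ φ g ∈ P) ∧ φ g = y := by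
  obtain ⟨g, hg, hφ⟩ := exists_mem_graphBall_φ_eq hstep w₀ y
  exact ⟨g, ⟨graphBall_mono G w₀ hR hg, hφ ▸ hy⟩, hφ⟩

/-- A vertex `n` steps from `w₀` in the direction `−σ e_i`: `φ g = φ w₀ − n σ e_i`, `g ∈ B_G(w₀, n)`. [folklore] -/
theorem exists_mem_graphBall_φ_eq_sub_single (hstep : Steps G φ) (w₀ : V) (i : Fin 2) (σ : ℤˣ) (n : ℕ) :
    ∃ g, g ∈ graphBall G w₀ n ∧ φ g = φ w₀ - Pi.single i ((σ : ℤ) * n) := by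
  obtain ⟨g, hg, hφ⟩ := exists_mem_graphBall_φ_eq hstep w₀ (φ w₀ - Pi.single i ((σ : ℤ) * n))
  refine ⟨g, graphBall_mono G w₀ ?_ hg, hφ⟩
  fin_cases i <;> rcases Int.units_eq_one_or σ with hσ | hσ <;> simp [hσ]

/-! ## §2 The rectangle centre behind a slab and the near side -/

/-- **The rectangle centre** behind a slab centred at `t` with inward normal `(i, σ)`, slab half-width `ℓs`, rectangle half-widths `a`: a vertex with
`φ c = φ t − (ℓs + 1 + a i) σ e_i`, within graph distance `ℓs + 1 + a i` of `t` (outward steps; a choice). [cite: KozmaNitzan2024, §4 p. 21 (v(P))] -/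
def rectCtr (hstep : Steps G φ) (t : V) (i : Fin 2) (σ : ℤˣ) (ℓs : ℕ) (a : Fin 2 → ℕ) : V :=
  Classical.choose (exists_mem_graphBall_φ_eq_sub_single hstep t i σ (ℓs + 1 + a i))

/-- Specification of the rectangle centre. [folklore] -/
theorem rectCtr_spec (hstep : Steps G φ) (t : V) (i : Fin 2) (σ : ℤˣ) (ℓs : ℕ) (a : Fin 2 → ℕ) :
    rectCtr hstep t i σ ℓs a ∈ graphBall G t (ℓs + 1 + a i) ∧
      φ (rectCtr hstep t i σ ℓs a) = φ t - Pi.single i ((σ : ℤ) * ((ℓs + 1 + a i : ℕ) : ℤ)) :=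
  Classical.choose_spec (exists_mem_graphBall_φ_eq_sub_single hstep t i σ (ℓs + 1 + a i))

/-- The rectangle centre lies within graph distance `ℓs + 1 + a i` of the slab centre. [folklore] -/
theorem rectCtr_mem_graphBall (hstep : Steps G φ) (t : V) (i : Fin 2) (σ : ℤˣ) (ℓs : ℕ) (a : Fin 2 → ℕ) :
    rectCtr hstep t i σ ℓs a ∈ graphBall G t (ℓs + 1 + a i) :=
  (rectCtr_spec hstep t i σ ℓs a).1

/-- The skeleton coordinates of the rectangle centre. [folklore] -/
theorem φ_rectCtr (hstep : Steps G φ) (t : V) (i : Fin 2) (σ : ℤˣ) (ℓs : ℕ) (a : Fin 2 → ℕ) :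
    φ (rectCtr hstep t i σ ℓs a) i = φ t i - (σ : ℤ) * ((ℓs + 1 + a i : ℕ) : ℤ) ∧ φ (rectCtr hstep t i σ ℓs a) (oth i) = φ t (oth i) := by
  have h := (rectCtr_spec hstep t i σ ℓs a).2
  constructor
  · rw [h, Pi.sub_apply, Pi.single_eq_same]
  · rw [h, Pi.sub_apply, Pi.single_eq_of_ne (oth_ne i), sub_zero]

variable (G) in
/-- **The near side of the kit rectangle**: the directed side `rside c a R i σ` of the fat rectangle at the rectangle centre, facing the slab.
[cite: KozmaNitzan2024, §4 p. 21 (U(P))] -/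
def nearSide [G.LocallyFinite] (hstep : Steps G φ) (t : V) (i : Fin 2) (σ : ℤˣ) (ℓs : ℕ) (a : Fin 2 → ℕ) (R : ℕ) : Finset V :=
  rside G φ (rectCtr hstep t i σ ℓs a) a R i σ

/-- The near side lies in the kit rectangle. [folklore] -/
theorem nearSide_subset_rectPrismFin [G.LocallyFinite] (hstep : Steps G φ) (t : V) (i : Fin 2) (σ : ℤˣ) (ℓs : ℕ) (a : Fin 2 → ℕ) (R : ℕ) :
    nearSide G hstep t i σ ℓs a R ⊆ rectPrismFin G φ (rectCtr hstep t i σ ℓs a) a R :=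
  rside_subset G φ _ a R i σ

/-! ## §3 The obligations of the kit rectangle and its near side -/

section Obligations

variable [G.LocallyFinite] (hstep : Steps G φ) (t : V) (i : Fin 2) (σ : ℤˣ) (ℓs : ℕ) (a : Fin 2 → ℕ) (R : ℕ)

/-- **Coordinates of a near-side vertex**: exit coordinate `φ u i = φ t i − σ (ℓs + 1)`, transverse offset `|φ u i' − φ t i'| ≤ a i'`.
[cite: KozmaNitzan2024, §4 p. 21 (U(P))] -/
theorem φ_nearSide {u : V} (hu : u ∈ nearSide G hstep t i σ ℓs a R) :
    φ u i = φ t i - (σ : ℤ) * (ℓs + 1) ∧ |φ u (oth i) - φ t (oth i)| ≤ a (oth i) := by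
  have hside := (mem_rside G φ).1 hu
  have htr := abs_oth_le_of_mem_rside G φ hu
  obtain ⟨hci, hco⟩ := φ_rectCtr hstep t i σ ℓs a
  rw [hco] at htr
  refine ⟨?_, htr⟩
  have h2 := hside.2
  rw [hci] at h2
  push_cast at h2
  rcases Int.units_eq_one_or σ with hσ | hσ <;> rw [hσ] at h2 ⊢ <;> push_cast at h2 ⊢ <;> linarith

omit [G.LocallyFinite] in
/-- **The whole kit rectangle lies within graph distance `ℓs + 1 + a i + R` of the slab centre.** [folklore] -/
theorem rectPrism_rectCtr_subset_graphBall : rectPrism G φ (rectCtr hstep t i σ ℓs a) a R ⊆ graphBall G t (ℓs + 1 + a i + R) := fun _ hu =>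
  BoxProdZ2.mem_graphBall_add G (rectCtr_mem_graphBall hstep t i σ ℓs a) (rectPrism_subset_graphBall G φ _ a R hu)

/-- The near side lies within graph distance `ℓs + 1 + a i + R` of the slab centre. [folklore] -/
theorem nearSide_subset_graphBall {u : V} (hu : u ∈ nearSide G hstep t i σ ℓs a R) : u ∈ graphBall G t (ℓs + 1 + a i + R) :=
  rectPrism_rectCtr_subset_graphBall hstep t i σ ℓs a R ((mem_rectPrismFin G φ).1 (nearSide_subset_rectPrismFin hstep t i σ ℓs a R hu))

omit [G.LocallyFinite] in
/-- **The whole kit rectangle has skeleton coordinates within `Λ_{ℓs + 1 + 2 a_i ⊔ a_{i'}}` of `φ t`.** [folklore] -/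
theorem rectPrism_rectCtr_subset_cyl : rectPrism G φ (rectCtr hstep t i σ ℓs a) a R ⊆ cyl φ t (max (ℓs + 1 + 2 * a i) (a (oth i))) := by
  intro u hu
  obtain ⟨hci, hco⟩ := φ_rectCtr hstep t i σ ℓs a
  have hb := mem_abox.1 hu.2
  rw [mem_cyl, mem_box]
  intro k
  simp only [Pi.sub_apply]
  have hmax1 : ((ℓs + 1 + 2 * a i : ℕ) : ℤ) ≤ ((max (ℓs + 1 + 2 * a i) (a (oth i)) : ℕ) : ℤ) := by exact_mod_cast le_max_left _ _
  have hmax2 : ((a (oth i) : ℕ) : ℤ) ≤ ((max (ℓs + 1 + 2 * a i) (a (oth i)) : ℕ) : ℤ) := by exact_mod_cast le_max_right _ _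
  by_cases hk : k = i
  · subst hk
    have h := hb k
    simp only [Pi.sub_apply] at h
    rw [hci] at h
    push_cast at h hmax1 ⊢
    rcases Int.units_eq_one_or σ with hσ | hσ <;> rw [hσ] at h <;> push_cast at h <;> constructor <;> linarith [h.1, h.2]
  · rw [eq_oth_of_ne hk]
    have h := hb (oth i)
    simp only [Pi.sub_apply] at h
    rw [hco] at h
    constructor <;> linarith [h.1, h.2]

/-- The near side has skeleton coordinates within `Λ_{ℓs + 1 + 2 a_i ⊔ a_{i'}}` of `φ t`. [folklore] -/
theorem nearSide_subset_cyl {u : V} (hu : u ∈ nearSide G hstep t i σ ℓs a R) : u ∈ cyl φ t (max (ℓs + 1 + 2 * a i) (a (oth i))) :=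
  rectPrism_rectCtr_subset_cyl hstep t i σ ℓs a R ((mem_rectPrismFin G φ).1 (nearSide_subset_rectPrismFin hstep t i σ ℓs a R hu))

/-- **Each near-side vertex has a `G`-neighbour inside the slab's fat prism** (the rung into the seed slab): the `Steps`-neighbour `u⁺` with
`φ u⁺ = φ u + σ e_i` has exit coordinate at distance exactly `ℓs` from `φ t i` and transverse offset `≤ a i' ≤ ℓs`, and lies in `B_G(t, ℓs + 2 + a i + R)`,
hence in `cylBall t ℓs (cylRadMax ℓs (ℓs + 2 + a i + R))` by `prism_subset_cylBall` (at any centre: `Frames` + (κ)).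
[cite: KozmaNitzan2024, §4 p. 21 (the edges into U(P))] -/
theorem exists_step_mem_cylBall_of_mem_nearSide {types : Finset V} (hfr : Frames G φ types) (hκ : CylConn G φ types) (hℓs : 1 ≤ ℓs)
    (ha : a (oth i) ≤ ℓs) {u : V} (hu : u ∈ nearSide G hstep t i σ ℓs a R) :
    ∃ v ∈ cylBall G φ t ℓs (cylRadMax G φ types ℓs (ℓs + 2 + a i + R)), G.Adj v u := by
  obtain ⟨v, hadj, hφv⟩ := hstep u i σ
  obtain ⟨hi, htr⟩ := φ_nearSide hstep t i σ ℓs a R hu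
  have htr' := abs_le.1 htr
  have ha' : ((a (oth i) : ℕ) : ℤ) ≤ ℓs := by exact_mod_cast ha
  refine ⟨v, prism_subset_cylBall hfr hκ t hℓs _ ⟨?_, ?_⟩, hadj.symm⟩
  · -- graph distance: `u` within `ℓs + 1 + a i + R`, one more step
    have := BoxProdZ2.mem_graphBall_succ_of_adj G (nearSide_subset_graphBall hstep t i σ ℓs a R hu) hadj
    exact graphBall_mono G t (by omega) this
  · -- skeleton coordinates: exit coordinate exactly `ℓs` from `φ t`, transverse within `a i' ≤ ℓs`
    rw [mem_box]
    intro k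
    rw [Pi.sub_apply, hφv, Pi.add_apply]
    by_cases hk : k = i
    · subst hk
      rw [Pi.single_eq_same]
      rcases Int.units_eq_one_or σ with hσ | hσ <;> rw [hσ] at hi ⊢ <;> push_cast at hi ⊢ <;> constructor <;> linarith
    · rw [Pi.single_eq_of_ne hk, add_zero, eq_oth_of_ne hk]
      constructor <;> linarith [htr'.1, htr'.2]

end Obligations

end Skelφ

end Summit.CriticalPhenomena.PercolationContinuityZ3.Theorems.Transplant

end
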